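import Literature.AlgebraicGeometry.Motives.MixedHodgeStructureOfPair
import Mathlib.Algebra.Homology.QuasiIso
import HarnessLib

/-!
# The long exact sequence of a pair of varieties, inside the category of pairs

For a pair `Y = (X, D)` of `k`-schemes over a subfield `k ⊆ ℂ` (`SchemePair`, with relative
Betti cohomology `SchemePair.bettiCohomology Y n = Hⁿ(X(ℂ), D(ℂ); ℚ)` of
`MixedHodgeStructureOfPair.lean`), the long exact cohomology sequence of the pair
(Hatcher, *Algebraic Topology*, §3.1, p. 200)
`⋯ → Hⁿ(X, D) → Hⁿ(X) → Hⁿ(D) --∂--> Hⁿ⁺¹(X, D) → Hⁿ⁺¹(X) → ⋯`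
is written here with every term the Betti cohomology of a *pair*: `Hⁿ(X) = Hⁿ((X, ∅))`,
`Hⁿ(D) = Hⁿ((D, ∅))`, the maps being the pull-backs along the canonical morphisms of pairs
`ofSchemeHom Y : (X, ∅) ⟶ (X, D)` and `Hom.ofScheme Y.ι : (D, ∅) ⟶ (X, ∅)` and the connecting map
`bettiCohomology.boundary Y n : Hⁿ((D, ∅)) ⟶ Hⁿ⁺¹((X, D))`. This is the shape in which the
hypothesis structure `MixedHodgeStructureOfPair` asserts that all maps are morphisms of mixed
Hodge structures (`map_isHom`, `boundary_isHom`); the present file supplies the (purely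
topological) **exactness** at the three kinds of places, transported from the tree's long exact
sequence of the pair of spaces `(X(ℂ), ι(D(ℂ)))` (`RelativeCochains.lean`:
`exact_toAbsolute_map`, `exact_map_δ`, `exact_δ_toAbsolute`) along the isomorphisms
`Hⁿ((X, ∅)) ≅ Hⁿ(X(ℂ))` (`toAbsolute` for an empty closed part) and
`Hⁿ((D, ∅)) ≅ Hⁿ(D(ℂ)) ≅ Hⁿ(ι(D(ℂ)))` (the homeomorphism `subHomeomorph`).

## Main results

* `relCochains_eq_top_of_eq_empty`, `isIso_ι_of_eq_empty`, `isIso_toAbsolute_of_eq_empty`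
  (namespace `Literature.AlgebraicTopology.SingularHomology`): for `A = ∅` every cochain is
  relative and `Hⁿ(X, ∅) ⟶ Hⁿ(X)` is an isomorphism (Hatcher §3.1, p. 199).
* `SchemePair.absIso X n : Hⁿ((X, ∅)) ≅ Hⁿ(X(ℂ))`, `SchemePair.subIso Y n : Hⁿ((D, ∅)) ≅ Hⁿ(ι(D(ℂ)))`
  and the commuting squares `map_ofSchemeHom_comp_absIso_hom`, `map_ofScheme_comp_subIso_hom`,
  `boundary_eq`.
* `SchemePair.exact_map_ofSchemeHom_map_ofScheme` (exactness at `Hⁿ((X, ∅))`),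
  `SchemePair.exact_map_ofScheme_boundary` (at `Hⁿ((D, ∅))`),
  `SchemePair.exact_boundary_map_ofSchemeHom` (at `Hⁿ⁺¹((X, D))`), together with the vanishing
  of the three composites.

Everything is proved; no named facts. Deliberately NOT here: naturality of the pair-form
sequence in `Y`, excision, the sequence of a triple.

## References

* A. Hatcher, *Algebraic Topology*, CUP 2002, §3.1, pp. 199–200. [Hatcher2002]
-/

noncomputable section

open CategoryTheory Limits Topology

universe u v

/-! ### Relative cochains with empty closed part -/

namespace Literature.AlgebraicTopology.SingularHomology

variable {R : Type v} [CommRing R] {M : Type v} [AddCommGroup M] [Module R M]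
variable {X : Type u} [TopologicalSpace X]

/-- For `A = ∅` every cochain is a relative cochain: no singular simplex has image in `∅`
(Hatcher 2002, §3.1 p. 199: `Cⁿ(X, ∅; G) = Cⁿ(X; G)`). [cite: Hatcher2002, §3.1 p. 199] -/
lemma relCochains_eq_top_of_eq_empty {A : Set X} (hA : A = ∅) (n : ℕ) :
    relCochains R M A n = ⊤ := by
  subst hA
  refine eq_top_iff.2 fun φ _ σ hσ => ?_
  exact absurd (Set.subset_empty_iff.1 hσ ▸ σ.range_nonempty) Set.not_nonempty_empty

/-- For `A = ∅` the inclusion `C^•(X, ∅; M) ⟶ C^•(X; M)` is an isomorphism of cochain complexes.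
[cite: Hatcher2002, §3.1 p. 199] -/
lemma isIso_ι_of_eq_empty {A : Set X} (hA : A = ∅) : IsIso (relCochainComplex.ι R M A) := by
  haveI : ∀ n, IsIso ((relCochainComplex.ι R M A).f n) := fun n =>
    (ConcreteCategory.isIso_iff_bijective _).2
      ⟨relCochainComplex.ι_f_injective, fun φ =>
        ⟨relCochainComplex.mk φ (by rw [relCochains_eq_top_of_eq_empty hA]; trivial), rfl⟩⟩
  exact HomologicalComplex.Hom.isIso_of_components _

/-- For `A = ∅`, `Hⁿ(X, ∅; M) ⟶ Hⁿ(X; M)` is an isomorphism (Hatcher 2002, §3.1 p. 199).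
[cite: Hatcher2002, §3.1 p. 199] -/
lemma isIso_toAbsolute_of_eq_empty {A : Set X} (hA : A = ∅) (n : ℕ) :
    IsIso (relSingularCohomology.toAbsolute R M X A n) := by
  haveI := isIso_ι_of_eq_empty (R := R) (M := M) hA
  change IsIso (HomologicalComplex.homologyMap (relCochainComplex.ι R M A) n)
  infer_instance

/-- The composite `Hⁿ(X, A) → Hⁿ(X) → Hⁿ(A)` vanishes (Hatcher 2002, §3.1 p. 200; the `zero`
of the tree's `exact_toAbsolute_map`, restated; a private copy — the same statement is
`relSingularCohomology.toAbsolute_comp_map_subsetIncl` of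
`Literature/Topology/FourManifolds/SphereSurgerySignature.lean`, not imported here).
[cite: Hatcher2002, §3.1 p. 200] -/
private lemma relSingularCohomology.toAbsolute_comp_restrict (A : Set X) (n : ℕ) :
    relSingularCohomology.toAbsolute R M X A n ≫ singularCohomology.map R M (subsetIncl A) n = 0 := by
  change HomologicalComplex.homologyMap (relShortComplex R M A).f n ≫
    HomologicalComplex.homologyMap (relShortComplex R M A).g n = 0
  rw [← HomologicalComplex.homologyMap_comp, (relShortComplex R M A).zero,
    HomologicalComplex.homologyMap_zero]

end Literature.AlgebraicTopology.SingularHomology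

/-! ### The comparison isomorphisms and the exactness -/

namespace Literature.AlgebraicGeometry.Motives

namespace SchemePair

open Literature.AlgebraicTopology.SingularHomology

variable {k : Type} [Field k] [Algebra k ℂ]

/-- `Hⁿ((X, ∅)) ≅ Hⁿ(X(ℂ); ℚ)`: the closed part of the pair `(X, ∅)` has no complex points
(`pointsSub_ofScheme`), so `toAbsolute` is an isomorphism. [cite: Hatcher2002, §3.1 p. 199] -/
def absIso (X : SchemeOver k) (n : ℕ) :
    (ofScheme X).bettiCohomology n ≅ singularCohomology ℚ ℚ (ComplexPoints X) n :=
  @asIso _ _ _ _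
    (relSingularCohomology.toAbsolute ℚ ℚ (ComplexPoints (ofScheme X).X) ((ofScheme X).pointsSub ℂ) n)
    (isIso_toAbsolute_of_eq_empty (pointsSub_ofScheme (L := ℂ) X) n)

/-- `absIso` is `toAbsolute` (by `rfl`). [folklore] -/
lemma absIso_hom (X : SchemeOver k) (n : ℕ) :
    (absIso X n).hom =
      relSingularCohomology.toAbsolute ℚ ℚ (ComplexPoints (ofScheme X).X) ((ofScheme X).pointsSub ℂ) n :=
  rfl

/-- The isomorphism `Hⁿ(D(ℂ); ℚ) ≅ Hⁿ(ι(D(ℂ)); ℚ)` induced by the homeomorphism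
`subHomeomorph : D(ℂ) ≃ₜ ι(D(ℂ))` (pull-back along its inverse). [folklore] -/
def subHomeomorphIso (Y : SchemePair k) (n : ℕ) :
    singularCohomology ℚ ℚ (ComplexPoints Y.D) n ≅ singularCohomology ℚ ℚ ↥(Y.pointsSub ℂ) n where
  hom := singularCohomology.map ℚ ℚ (Y.subHomeomorph.symm : C(↥(Y.pointsSub ℂ), ComplexPoints Y.D)) n
  inv := singularCohomology.map ℚ ℚ (Y.subHomeomorph : C(ComplexPoints Y.D, ↥(Y.pointsSub ℂ))) n
  hom_inv_id := by
    rw [← singularCohomology.map_comp, Homeomorph.symm_comp_toContinuousMap,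
      singularCohomology.map_id]
  inv_hom_id := by
    rw [← singularCohomology.map_comp, Homeomorph.toContinuousMap_comp_symm,
      singularCohomology.map_id]

/-- `Hⁿ((D, ∅)) ≅ Hⁿ(ι(D(ℂ)); ℚ)`: `absIso` for `D` followed by `subHomeomorphIso`. [folklore] -/
def subIso (Y : SchemePair k) (n : ℕ) :
    (ofScheme Y.D).bettiCohomology n ≅ singularCohomology ℚ ℚ ↥(Y.pointsSub ℂ) n :=
  absIso Y.D n ≪≫ subHomeomorphIso Y n

/-- The connecting map in pair form is `subIso` followed by the tree's `δ`. [folklore] -/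
lemma boundary_eq (Y : SchemePair k) (n : ℕ) :
    bettiCohomology.boundary Y n =
      (subIso Y n).hom ≫ relSingularCohomology.δ ℚ ℚ (ComplexPoints Y.X) (Y.pointsSub ℂ) n (n + 1) rfl := by
  rw [subIso, Iso.trans_hom, absIso_hom]
  exact (Category.assoc _ _ _).symm

/-- `j^*` in pair form is `toAbsolute`: `map (ofSchemeHom Y) n ≫ absIso = toAbsolute`
(naturality of `toAbsolute`, Hatcher 2002, §3.1 p. 200). [cite: Hatcher2002, §3.1 p. 200] -/
lemma map_ofSchemeHom_comp_absIso_hom (Y : SchemePair k) (n : ℕ) :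
    bettiCohomology.map (ofSchemeHom Y) n ≫ (absIso Y.X n).hom =
      relSingularCohomology.toAbsolute ℚ ℚ (ComplexPoints Y.X) (Y.pointsSub ℂ) n := by
  have h := relSingularCohomology.map_comp_toAbsolute (R := ℚ) (M := ℚ)
    (AlgPoints.mapContinuous (L := ℂ) (ofSchemeHom Y).fX)
    (Hom.mapsTo_pointsSub_mapContinuous (ofSchemeHom Y)) n
  rw [absIso_hom]
  refine h.trans ?_
  -- `(ofSchemeHom Y).fX = 𝟙 Y.X`, and `(𝟙 X)^* = 𝟙` on Betti cohomology
  change _ ≫ _root_.Literature.AlgebraicGeometry.Motives.bettiCohomology.map (𝟙 Y.X) n = _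
  simp only [_root_.Literature.AlgebraicGeometry.Motives.bettiCohomology.map_id, Category.comp_id]

/-- Restriction in pair form is restriction to the subspace:
`map (Hom.ofScheme Y.ι) n ≫ subIso = absIso ≫ (ι(D(ℂ)) ↪ X(ℂ))^*`. [cite: Hatcher2002, §3.1 p. 200] -/
lemma map_ofScheme_comp_subIso_hom (Y : SchemePair k) (n : ℕ) :
    bettiCohomology.map (Hom.ofScheme Y.ι) n ≫ (subIso Y n).hom =
      (absIso Y.X n).hom ≫ singularCohomology.map ℚ ℚ (subsetIncl (Y.pointsSub ℂ)) n := by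
  have hι : (AlgPoints.mapContinuous (L := ℂ) Y.ι).comp
      (Y.subHomeomorph.symm : C(↥(Y.pointsSub ℂ), ComplexPoints Y.D)) =
        subsetIncl (Y.pointsSub ℂ) := by
    refine ContinuousMap.ext fun a => ?_
    change AlgPoints.map Y.ι (Y.subHomeomorph.symm a) = (a : ComplexPoints Y.X)
    rw [← subHomeomorph_apply_coe, Homeomorph.apply_symm_apply]
  have h := relSingularCohomology.map_comp_toAbsolute (R := ℚ) (M := ℚ)
    (AlgPoints.mapContinuous (L := ℂ) (Hom.ofScheme Y.ι).fX)
    (Hom.mapsTo_pointsSub_mapContinuous (Hom.ofScheme Y.ι)) n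
  rw [subIso, Iso.trans_hom, absIso_hom, absIso_hom, ← Category.assoc]
  change (bettiCohomology.map (Hom.ofScheme Y.ι) n ≫ _) ≫ singularCohomology.map ℚ ℚ _ n = _
  rw [h, Category.assoc, ← singularCohomology.map_comp]
  change _ ≫ singularCohomology.map ℚ ℚ ((AlgPoints.mapContinuous (L := ℂ) Y.ι).comp _) n = _
  rw [hι]

/-! #### The commuting squares with the tree's sequence (inverse form) -/

/-- Square 1: `map (ofSchemeHom Y) n = toAbsolute ≫ absIso⁻¹`. [folklore] -/
lemma id_comp_map_ofSchemeHom (Y : SchemePair k) (n : ℕ) :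
    𝟙 _ ≫ bettiCohomology.map (ofSchemeHom Y) n =
      relSingularCohomology.toAbsolute ℚ ℚ (ComplexPoints Y.X) (Y.pointsSub ℂ) n ≫ (absIso Y.X n).inv := by
  rw [Category.id_comp]
  exact (Iso.eq_comp_inv _).2 (map_ofSchemeHom_comp_absIso_hom Y n)

/-- Square 2: `absIso⁻¹ ≫ map (Hom.ofScheme Y.ι) n = (ι(D(ℂ)) ↪ X(ℂ))^* ≫ subIso⁻¹`. [folklore] -/
lemma absIso_inv_comp_map_ofScheme (Y : SchemePair k) (n : ℕ) :
    (absIso Y.X n).inv ≫ bettiCohomology.map (Hom.ofScheme Y.ι) n =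
      singularCohomology.map ℚ ℚ (subsetIncl (Y.pointsSub ℂ)) n ≫ (subIso Y n).inv := by
  rw [Iso.inv_comp_eq, ← Category.assoc, Iso.eq_comp_inv]
  exact map_ofScheme_comp_subIso_hom Y n

/-- Square 3: `subIso⁻¹ ≫ boundary Y n = δ`. [folklore] -/
lemma subIso_inv_comp_boundary (Y : SchemePair k) (n : ℕ) :
    (subIso Y n).inv ≫ bettiCohomology.boundary Y n =
      relSingularCohomology.δ ℚ ℚ (ComplexPoints Y.X) (Y.pointsSub ℂ) n (n + 1) rfl ≫ 𝟙 _ := by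
  rw [Category.comp_id, Iso.inv_comp_eq]
  exact boundary_eq Y n

/-! #### Exactness -/

/-- `Hⁿ((X, D)) → Hⁿ((X, ∅)) → Hⁿ((D, ∅))` composes to zero. [cite: Hatcher2002, §3.1 p. 200] -/
lemma map_ofSchemeHom_comp_map_ofScheme (Y : SchemePair k) (n : ℕ) :
    bettiCohomology.map (ofSchemeHom Y) n ≫ bettiCohomology.map (Hom.ofScheme Y.ι) n = 0 := by
  have h := id_comp_map_ofSchemeHom Y n
  rw [Category.id_comp] at h
  rw [h, Category.assoc, absIso_inv_comp_map_ofScheme, ← Category.assoc,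
    relSingularCohomology.toAbsolute_comp_restrict, zero_comp]

/-- **Exactness at `Hⁿ((X, ∅))`** of the pair-form sequence
`Hⁿ((X, D)) → Hⁿ((X, ∅)) → Hⁿ((D, ∅))` (Hatcher 2002, §3.1 p. 200). [cite: Hatcher2002, §3.1 p. 200] -/
theorem exact_map_ofSchemeHom_map_ofScheme (Y : SchemePair k) (n : ℕ) :
    (ShortComplex.mk (bettiCohomology.map (ofSchemeHom Y) n)
      (bettiCohomology.map (Hom.ofScheme Y.ι) n) (map_ofSchemeHom_comp_map_ofScheme Y n)).Exact := by
  refine ShortComplex.exact_of_iso ?_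
    (relSingularCohomology.exact_toAbsolute_map (R := ℚ) (M := ℚ) (Y.pointsSub ℂ) n)
  exact ShortComplex.isoMk (Iso.refl _) (absIso Y.X n).symm (subIso Y n).symm
    (id_comp_map_ofSchemeHom Y n) (absIso_inv_comp_map_ofScheme Y n)

/-- `Hⁿ((X, ∅)) → Hⁿ((D, ∅)) → Hⁿ⁺¹((X, D))` composes to zero. [cite: Hatcher2002, §3.1 p. 200] -/
lemma map_ofScheme_comp_boundary (Y : SchemePair k) (n : ℕ) :
    bettiCohomology.map (Hom.ofScheme Y.ι) n ≫ bettiCohomology.boundary Y n = 0 := by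
  rw [← cancel_epi (absIso Y.X n).inv, ← Category.assoc, absIso_inv_comp_map_ofScheme,
    Category.assoc, subIso_inv_comp_boundary, Category.comp_id, comp_zero]
  exact (relShortComplex_shortExact ℚ ℚ (Y.pointsSub ℂ)).comp_δ n (n + 1) rfl

/-- **Exactness at `Hⁿ((D, ∅))`**: `Hⁿ((X, ∅)) → Hⁿ((D, ∅)) → Hⁿ⁺¹((X, D))`
(Hatcher 2002, §3.1 p. 200). [cite: Hatcher2002, §3.1 p. 200] -/
theorem exact_map_ofScheme_boundary (Y : SchemePair k) (n : ℕ) :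
    (ShortComplex.mk (bettiCohomology.map (Hom.ofScheme Y.ι) n) (bettiCohomology.boundary Y n)
      (map_ofScheme_comp_boundary Y n)).Exact := by
  refine ShortComplex.exact_of_iso ?_
    (relSingularCohomology.exact_map_δ (R := ℚ) (M := ℚ) (Y.pointsSub ℂ) n (n + 1) rfl)
  exact ShortComplex.isoMk (absIso Y.X n).symm (subIso Y n).symm (Iso.refl _)
    (absIso_inv_comp_map_ofScheme Y n) (subIso_inv_comp_boundary Y n)

/-- `Hⁿ((D, ∅)) → Hⁿ⁺¹((X, D)) → Hⁿ⁺¹((X, ∅))` composes to zero. [cite: Hatcher2002, §3.1 p. 200] -/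
lemma boundary_comp_map_ofSchemeHom (Y : SchemePair k) (n : ℕ) :
    bettiCohomology.boundary Y n ≫ bettiCohomology.map (ofSchemeHom Y) (n + 1) = 0 := by
  have h := id_comp_map_ofSchemeHom Y (n + 1)
  rw [Category.id_comp] at h
  have z : relSingularCohomology.δ ℚ ℚ (ComplexPoints Y.X) (Y.pointsSub ℂ) n (n + 1) rfl ≫
      relSingularCohomology.toAbsolute ℚ ℚ (ComplexPoints Y.X) (Y.pointsSub ℂ) (n + 1) = 0 :=
    (relShortComplex_shortExact ℚ ℚ (Y.pointsSub ℂ)).δ_comp n (n + 1) rfl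
  rw [← cancel_epi (subIso Y n).inv, ← Category.assoc, subIso_inv_comp_boundary, Category.comp_id,
    h, ← Category.assoc, comp_zero, z, zero_comp]

/-- **Exactness at `Hⁿ⁺¹((X, D))`**: `Hⁿ((D, ∅)) → Hⁿ⁺¹((X, D)) → Hⁿ⁺¹((X, ∅))`
(Hatcher 2002, §3.1 p. 200). [cite: Hatcher2002, §3.1 p. 200] -/
theorem exact_boundary_map_ofSchemeHom (Y : SchemePair k) (n : ℕ) :
    (ShortComplex.mk (bettiCohomology.boundary Y n) (bettiCohomology.map (ofSchemeHom Y) (n + 1))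
      (boundary_comp_map_ofSchemeHom Y n)).Exact := by
  refine ShortComplex.exact_of_iso ?_
    (relSingularCohomology.exact_δ_toAbsolute (R := ℚ) (M := ℚ) (Y.pointsSub ℂ) n (n + 1) rfl)
  exact ShortComplex.isoMk (subIso Y n).symm (Iso.refl _) (absIso Y.X (n + 1)).symm
    (subIso_inv_comp_boundary Y n) (id_comp_map_ofSchemeHom Y (n + 1))

end SchemePair

end Literature.AlgebraicGeometry.Motives

end
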